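import Summits.AnomalousDissipation.AnomalousDissipation.Theorems.ImpulseGridGridInjectionIdentity
import Literature.Analysis.FluidPDE.LerayHopfSpectralMeasurability

/-!
# Route ImpulseGrid (AnomalousDissipation) — the Laplacian pairing bound

Stub `stub_laplacianPairingBound` (W1) of line `Sketch` for the crux
`Summit.AnomalousDissipation.AnomalousDissipation.Theses.ImpulseGrid.GridThesis`
(item `stmt-AnomalousDissipation-1770`); it is also a step of the route's Assembly item 1776.

For a global Leray–Hopf solution `u` on `T³` (any viscosity `ν`, steady force `f`) whose kinetic
energy is bounded on `[0, ∞)`, a smooth steady field `Z` with `‖ΔZ‖ ≤ M` pointwise, and any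
generalized (Banach) limit `Λ` at `+∞`:

`|Λ⟨(u, ΔZ)⟩| ≤ M (1 + ⟨‖u‖₂²⟩) / 2`, where `⟨‖u‖₂²⟩ = meanEnergy u = limsup_T T⁻¹ ∫₀ᵀ ‖u‖₂²`.

The bound is uniform in `ν`, which is what the work-split transfer of the line needs
(`|νⱼ Λ⟨(uⱼ, Δ(ΨG))⟩| → 0` along a family with `νⱼ → 0` and bounded mean energy).

Proof (Foias–Manley–Rosa–Temam 2001, Ch. IV §1.3 (1.38); Doering–Foias 2002 §2). Pointwise in
time, `|(u(t), ΔZ)| ≤ M ∫ ‖u(t)‖ ≤ (M/2)(1 + ‖u(t)‖₂²)` (`‖v‖ ≤ (1 + ‖v‖²)/2` on the probability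
space `T³`); both slice functionals are integrable on `(0, T]`, so the Cesàro means satisfy
`|T⁻¹ ∫₀ᵀ (u, ΔZ)| ≤ (M/2)(1 + T⁻¹ ∫₀ᵀ ‖u‖₂²)`; the energy means are bounded by the sup-energy
hypothesis, hence eventually `≤ ⟨‖u‖₂²⟩ + ε` (`limsup`), and `|Λ φ| ≤ c` whenever `|φ| ≤ c`
eventually (`GeneralizedLimit.abs_apply_le`); finally let `ε → 0`.

No new definitions.
-/

noncomputable section

-- `Summit.<Summit>.<Problem>` is the tree's mandated summit-side namespace (CONVENTIONS §2); for this
-- single-conjunct summit the two coincide, so the duplicate is deliberate.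
set_option linter.dupNamespace false

open MeasureTheory Set Filter Topology
open scoped InnerProductSpace RealInnerProductSpace

namespace Summit.AnomalousDissipation.AnomalousDissipation.Theorems

open Literature.Analysis.FluidPDE Literature.Analysis.FluidPDE.Torus
open Literature.Analysis.FunctionSpaces Literature.Analysis.FunctionSpaces.Torus

/-- **Cesàro bound for a dominated slice functional.** If `|g t| ≤ a (1 + e t)` for `t ≥ 0`
and `e` is integrable on `(0, T]`, `T > 0`, then `|T⁻¹ ∫₀ᵀ g| ≤ a (1 + T⁻¹ ∫₀ᵀ e)`. [folklore] -/
theorem laplacianPairing_abs_timeMean_le {g e : ℝ → ℝ} {a T : ℝ} (hT : 0 < T)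
    (hge : ∀ t, 0 ≤ t → |g t| ≤ a * (1 + e t)) (he : IntegrableOn e (Ioc 0 T)) :
    |timeMean g T| ≤ a * (1 + timeMean e T) := by
  have h1Int : IntegrableOn (fun _ : ℝ => (1 : ℝ)) (Ioc 0 T) :=
    integrableOn_const measure_Ioc_lt_top.ne
  have hbInt : IntegrableOn (fun t => a * (1 + e t)) (Ioc 0 T) := (h1Int.add he).const_mul a
  have hnorm : ‖∫ t in Ioc 0 T, g t‖ ≤ ∫ t in Ioc 0 T, a * (1 + e t) := by
    refine norm_integral_le_of_norm_le hbInt ?_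
    filter_upwards [ae_restrict_mem measurableSet_Ioc] with t ht
    rw [Real.norm_eq_abs]
    exact hge t ht.1.le
  have hcalc : ∫ t in Ioc 0 T, a * (1 + e t) = a * (T + ∫ t in Ioc 0 T, e t) := by
    rw [integral_const_mul, integral_add h1Int he, setIntegral_const, Real.volume_real_Ioc_of_le hT.le,
      sub_zero, smul_eq_mul, mul_one]
  rw [Real.norm_eq_abs] at hnorm
  simp only [timeMean, intervalIntegral.integral_of_le hT.le]
  rw [abs_mul, abs_inv, abs_of_pos hT]
  calc T⁻¹ * |∫ t in Ioc 0 T, g t| ≤ T⁻¹ * (a * (T + ∫ t in Ioc 0 T, e t)) :=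
        mul_le_mul_of_nonneg_left (hnorm.trans_eq hcalc) (inv_nonneg.2 hT.le)
    _ = a * (T⁻¹ * T + T⁻¹ * ∫ t in Ioc 0 T, e t) := by ring
    _ = a * (1 + T⁻¹ * ∫ t in Ioc 0 T, e t) := by rw [inv_mul_cancel₀ hT.ne']

/-- **Generalized limits of dominated functions.** If eventually `|φ T| ≤ a (1 + ψ T)` with
`a ≥ 0` and `ψ` eventually bounded above, then `|Λ φ| ≤ a (1 + limsup ψ)`
(`ψ ≤ limsup ψ + ε` eventually, `GeneralizedLimit.abs_apply_le`, and `ε → 0`). [folklore] -/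
theorem laplacianPairing_abs_apply_le_of_limsup (Λ : GeneralizedLimit) {φ ψ : ℝ → ℝ} {a : ℝ}
    (ha : 0 ≤ a) (hψ : IsBoundedUnder (· ≤ ·) atTop ψ)
    (hφ : ∀ᶠ T in atTop, |φ T| ≤ a * (1 + ψ T)) :
    |Λ φ| ≤ a * (1 + limsup ψ atTop) := by
  set L : ℝ := limsup ψ atTop with hL
  have key : ∀ ε : ℝ, 0 < ε → |Λ φ| ≤ a * (1 + L + ε) := by
    intro ε hε
    have hev : ∀ᶠ T in atTop, ψ T < L + ε := eventually_lt_of_limsup_lt (lt_add_of_pos_right L hε) hψ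
    refine Λ.abs_apply_le ?_
    filter_upwards [hφ, hev] with T hT hTε
    exact hT.trans (mul_le_mul_of_nonneg_left (by linarith) ha)
  refine le_of_forall_pos_le_add fun δ hδ => ?_
  have hM1 : 0 < a + 1 := by linarith
  have hfrac : a * (δ / (a + 1)) ≤ δ := by
    rw [← mul_div_assoc, div_le_iff₀ hM1]
    nlinarith
  calc |Λ φ| ≤ a * (1 + L + δ / (a + 1)) := key _ (div_pos hδ hM1)
    _ = a * (1 + L) + a * (δ / (a + 1)) := by ring
    _ ≤ a * (1 + L) + δ := by linarith

/-- **Stub (W1), the Laplacian pairing bound.** The viscous pairing `Λ⟨(u, ΔZ)⟩` of a global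
Leray–Hopf solution with sup-bounded kinetic energy against a smooth steady field `Z` with
`‖ΔZ‖ ≤ M` pointwise is bounded by `M (1 + ⟨‖u‖₂²⟩)/2`, uniformly in the viscosity
(pointwise `‖v‖ ≤ (1 + ‖v‖²)/2`, Cesàro means, and `|Λ φ| ≤ c` for `|φ| ≤ c` eventually;
Foias–Manley–Rosa–Temam 2001, Ch. IV §1.3 (1.38)). [folklore] -/
theorem stub_laplacianPairingBound :
    ∀ (Λ : GeneralizedLimit) (ν M : ℝ) (f Z u₀ : UnitAddTorus (Fin 3) → EuclideanSpace ℝ (Fin 3))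
      (u : ℝ → UnitAddTorus (Fin 3) → EuclideanSpace ℝ (Fin 3)),
      IsSmooth Z → (∀ x, ‖laplacian Z x‖ ≤ M) →
      IsGlobalLerayHopf ν (fun _ => f) u₀ u →
      (∃ C : ℝ, ∀ t : ℝ, 0 ≤ t → kineticEnergy (u t) ≤ C) →
      |Λ.longTimeAvg (fun t => ∫ x, ⟪u t x, laplacian Z x⟫)| ≤ M * (1 + meanEnergy u) / 2 := by
  intro Λ ν M f Z u₀ u _hZ hM hu hE
  obtain ⟨C, hC⟩ := hE
  have hM0 : 0 ≤ M := (norm_nonneg _).trans (hM 0)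
  -- (i) pointwise in time: `|(u(t), ΔZ)| ≤ (M/2)(1 + ‖u(t)‖₂²)` for `t ≥ 0`
  have hgt : ∀ t : ℝ, 0 ≤ t →
      |∫ x, ⟪u t x, laplacian Z x⟫| ≤ M / 2 * (1 + ∫ x, ‖u t x‖ ^ 2) := by
    intro t ht
    have hmem : MemLp (u t) 2 volume := (hu (t + 1) (by linarith)).memLp t ⟨ht, by linarith⟩
    calc |∫ x, ⟪u t x, laplacian Z x⟫| ≤ M * ∫ x, ‖u t x‖ :=
          abs_integral_inner_le_of_norm_le (hmem.integrable one_le_two) hM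
      _ ≤ M * (2⁻¹ * (1 + ∫ x, ‖u t x‖ ^ 2)) :=
          mul_le_mul_of_nonneg_left (integral_norm_le_of_memLp_two hmem) hM0
      _ = M / 2 * (1 + ∫ x, ‖u t x‖ ^ 2) := by ring
  -- (ii) Cesàro means: `|T⁻¹∫₀ᵀ (u, ΔZ)| ≤ (M/2)(1 + T⁻¹∫₀ᵀ ‖u‖₂²)` for `T > 0`
  have hces : ∀ᶠ T in atTop, |timeMean (fun t => ∫ x, ⟪u t x, laplacian Z x⟫) T| ≤
      M / 2 * (1 + timeMean (fun t => ∫ x, ‖u t x‖ ^ 2) T) :=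
    (eventually_gt_atTop 0).mono fun T hT =>
      laplacianPairing_abs_timeMean_le hT hgt (hu.integrableOn_integral_norm_sq hT)
  -- (iii) the energy means are bounded above (sup-energy hypothesis)
  have heabs : ∀ t : ℝ, 0 < t → |∫ x, ‖u t x‖ ^ 2| ≤ 2 * C := fun t ht => by
    rw [abs_of_nonneg (integral_nonneg fun x => sq_nonneg _)]
    have h := hC t ht.le
    simp only [kineticEnergy] at h
    linarith
  have hebdd : IsBoundedUnder (· ≤ ·) atTop (timeMean fun t => ∫ x, ‖u t x‖ ^ 2) :=
    isBoundedUnder_le_timeMean heabs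
  -- (iv) pass to the generalized limit
  have h := laplacianPairing_abs_apply_le_of_limsup Λ (by positivity : 0 ≤ M / 2) hebdd hces
  rw [meanEnergy_eq_longTimeAvgSup]
  unfold GeneralizedLimit.longTimeAvg longTimeAvgSup
  linarith

end Summit.AnomalousDissipation.AnomalousDissipation.Theorems
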